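import Mathlib

/-!
# Lovas–Andai's Lemma 6 — the slice calculus (one-variable antiderivatives and the radial section)

Auxiliary real analysis for the proof of `LovasAndai2017_lemma6`
(`Literature/Probability/RandomMatrix/LovasAndaiDefectFunction.lean`). With `S = sinh σ > 0`,
`C = cosh σ` (`C² = 1 + S²`) and `(u, w) ∈ ℝ²`, the hyperbolic slice of the operator-norm ball of
`ℝ^{2×2}` at hyperbolic angle `σ` is the set of `ℓ > 0` with
`√(u² + ℓ²C²) + √(w² + ℓ²S²) < 2`. This file proves:

* `slice_radius_iff`, `slice_radius_pos`, `slice_radius_nonneg`: for `|u| + |w| < 2` that set is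
  `ℓ² < L(u,w) := 4 + w² − u² + 8S² − 4√(C²(4S²+w²) − S²u²)` (squaring twice; `L > 0`), and it is
  empty for `|u| + |w| ≥ 2`; `slice_radial_lintegral`: `∫_{ℓ>0} ℓ 𝟙[…] dℓ = L/2`.
* `hasDerivAt_sqrt_sub_sq`: `d/du [u/2 √(A−S²u²) + A/(2S) arcsin(Su/√A)] = √(A−S²u²)`.
* `hasDerivAt_arcsin_antideriv`: with `θ(w) = S(2−w)/(C√(4S²+w²))`,
  `d/dw [(4S²w + w³/3) arcsin θ(w) + 2S(w²/6 + (4S²/3) log(4S²+w²))] = (4S²+w²) arcsin θ(w)`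
  for `w > −2S²` (the key identity `1 − θ² = (w+2S²)²/(C²(4S²+w²))`, `one_sub_theta_sq`).

These replace the explicit atlas computation of [LovasAndai2017, Appendix A]; the two
antiderivatives are the whole transcendental content of their Lemma 6.

## References

* [LovasAndai2017] A. Lovas, A. Andai, J. Phys. A 50 (2017) 295303, Lemma 6 and Appendix A.
  arXiv:1610.01410.
-/

noncomputable section

open Real Set MeasureTheory
open scoped ENNReal

namespace Literature.Probability.RandomMatrix.LovasAndai

/-- Antiderivative of `√(A − S² u²)`:
`d/du [u/2 · √(A − S²u²) + A/(2S) · arcsin(S u/√A)] = √(A − S²u²)`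
where the radicand is positive. [folklore] -/
theorem hasDerivAt_sqrt_sub_sq {A S u : ℝ} (hA : 0 < A) (hS : 0 < S) (hR : 0 < A - S ^ 2 * u ^ 2) :
    HasDerivAt (fun u => u / 2 * Real.sqrt (A - S ^ 2 * u ^ 2) +
        A / (2 * S) * Real.arcsin (S * u / Real.sqrt A))
      (Real.sqrt (A - S ^ 2 * u ^ 2)) u := by
  have hsA : 0 < Real.sqrt A := Real.sqrt_pos.mpr hA
  have hsA2 : Real.sqrt A ^ 2 = A := Real.sq_sqrt hA.le
  have hsR : 0 < Real.sqrt (A - S ^ 2 * u ^ 2) := Real.sqrt_pos.mpr hR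
  have hsR2 : Real.sqrt (A - S ^ 2 * u ^ 2) ^ 2 = A - S ^ 2 * u ^ 2 := Real.sq_sqrt hR.le
  -- the inner function `A - S² u²`
  have hg : HasDerivAt (fun u => A - S ^ 2 * u ^ 2) (-(S ^ 2 * (2 * u))) u := by
    have := ((hasDerivAt_pow 2 u).const_mul (S ^ 2)).const_sub A
    simpa using this
  have hsqrt : HasDerivAt (fun u => Real.sqrt (A - S ^ 2 * u ^ 2))
      (-(S ^ 2 * (2 * u)) / (2 * Real.sqrt (A - S ^ 2 * u ^ 2))) u :=
    hg.sqrt hR.ne'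
  have h1 : HasDerivAt (fun u => u / 2 * Real.sqrt (A - S ^ 2 * u ^ 2))
      (1 / 2 * Real.sqrt (A - S ^ 2 * u ^ 2) +
        u / 2 * (-(S ^ 2 * (2 * u)) / (2 * Real.sqrt (A - S ^ 2 * u ^ 2)))) u := by
    have hu : HasDerivAt (fun u : ℝ => u / 2) (1 / 2) u := by
      simpa using (hasDerivAt_id u).div_const 2
    exact hu.mul hsqrt
  -- the arcsin part
  have hx : S * u / Real.sqrt A ≠ -1 ∧ S * u / Real.sqrt A ≠ 1 := by
    have hlt : (S * u / Real.sqrt A) ^ 2 < 1 := by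
      rw [div_pow, div_lt_one (by positivity), hsA2]
      nlinarith
    constructor
    · intro h; rw [h] at hlt; norm_num at hlt
    · intro h; rw [h] at hlt; norm_num at hlt
  have hroot : Real.sqrt (1 - (S * u / Real.sqrt A) ^ 2) =
      Real.sqrt (A - S ^ 2 * u ^ 2) / Real.sqrt A := by
    have : 1 - (S * u / Real.sqrt A) ^ 2 = (A - S ^ 2 * u ^ 2) / A := by
      rw [div_pow, hsA2]
      field_simp
    rw [this, Real.sqrt_div hR.le]
  have hin : HasDerivAt (fun u => S * u / Real.sqrt A) (S / Real.sqrt A) u := by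
    have := ((hasDerivAt_id u).const_mul S).div_const (Real.sqrt A)
    simpa using this
  have harc' := (Real.hasDerivAt_arcsin hx.1 hx.2).comp u hin
  have harc : HasDerivAt (fun u => Real.arcsin (S * u / Real.sqrt A))
      (1 / Real.sqrt (1 - (S * u / Real.sqrt A) ^ 2) * (S / Real.sqrt A)) u := harc'
  have h2 : HasDerivAt (fun u => A / (2 * S) * Real.arcsin (S * u / Real.sqrt A))
      (A / (2 * S) * (1 / Real.sqrt (1 - (S * u / Real.sqrt A) ^ 2) * (S / Real.sqrt A))) u :=
    harc.const_mul _
  have hsum : HasDerivAt (fun u => u / 2 * Real.sqrt (A - S ^ 2 * u ^ 2) +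
        A / (2 * S) * Real.arcsin (S * u / Real.sqrt A)) _ u := h1.add h2
  refine hsum.congr_deriv ?_
  rw [hroot]
  field_simp
  rw [hsR2]
  ring

/-- The auxiliary identity `1 − θ(w)² = (w + 2S²)² / (C²(4S²+w²))` for
`θ(w) = S(2−w)/(C√(4S²+w²))`, `C² = 1 + S²`. [folklore] -/
theorem one_sub_theta_sq {S C w : ℝ} (hS : 0 < S) (hC : 0 < C) (hCS : C ^ 2 = 1 + S ^ 2) :
    1 - (S * (2 - w) / (C * Real.sqrt (4 * S ^ 2 + w ^ 2))) ^ 2 =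
      (w + 2 * S ^ 2) ^ 2 / (C ^ 2 * (4 * S ^ 2 + w ^ 2)) := by
  have hρpos : 0 < 4 * S ^ 2 + w ^ 2 := by positivity
  have hρ2 : Real.sqrt (4 * S ^ 2 + w ^ 2) ^ 2 = 4 * S ^ 2 + w ^ 2 := Real.sq_sqrt hρpos.le
  have hρ : 0 < Real.sqrt (4 * S ^ 2 + w ^ 2) := Real.sqrt_pos.mpr hρpos
  rw [div_pow, mul_pow, mul_pow, hρ2]
  field_simp
  linear_combination (4 * S ^ 2 + w ^ 2) * hCS

/-- Antiderivative of `(4S² + w²) · arcsin θ(w)`, `θ(w) = S(2−w)/(C√(4S²+w²))`, valid for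
`w > −2S²` (where `d/dw arcsin θ(w) = −2S/(4S²+w²)`). [folklore] -/
theorem hasDerivAt_arcsin_antideriv {S C w : ℝ} (hS : 0 < S) (hC : 0 < C) (hCS : C ^ 2 = 1 + S ^ 2)
    (hw : -(2 * S ^ 2) < w) :
    HasDerivAt (fun w => (4 * S ^ 2 * w + w ^ 3 / 3) *
          Real.arcsin (S * (2 - w) / (C * Real.sqrt (4 * S ^ 2 + w ^ 2))) +
        2 * S * (w ^ 2 / 6 + 4 * S ^ 2 / 3 * Real.log (4 * S ^ 2 + w ^ 2)))
      ((4 * S ^ 2 + w ^ 2) *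
        Real.arcsin (S * (2 - w) / (C * Real.sqrt (4 * S ^ 2 + w ^ 2)))) w := by
  have hρpos : 0 < 4 * S ^ 2 + w ^ 2 := by positivity
  have hρ2 : Real.sqrt (4 * S ^ 2 + w ^ 2) ^ 2 = 4 * S ^ 2 + w ^ 2 := Real.sq_sqrt hρpos.le
  have hρ : 0 < Real.sqrt (4 * S ^ 2 + w ^ 2) := Real.sqrt_pos.mpr hρpos
  -- ρ(w) = √(4S²+w²)
  have hin : HasDerivAt (fun w => 4 * S ^ 2 + w ^ 2) (2 * w) w := by
    have := (hasDerivAt_pow 2 w).const_add (4 * S ^ 2)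
    simpa using this
  have hρd : HasDerivAt (fun w => Real.sqrt (4 * S ^ 2 + w ^ 2))
      (2 * w / (2 * Real.sqrt (4 * S ^ 2 + w ^ 2))) w := hin.sqrt hρpos.ne'
  -- θ(w)
  have hnum : HasDerivAt (fun w => S * (2 - w)) (-S) w := by
    have := ((hasDerivAt_id w).const_sub 2).const_mul S
    simpa using this
  have hden : HasDerivAt (fun w => C * Real.sqrt (4 * S ^ 2 + w ^ 2))
      (C * (2 * w / (2 * Real.sqrt (4 * S ^ 2 + w ^ 2)))) w := hρd.const_mul C
  have hθ : HasDerivAt (fun w => S * (2 - w) / (C * Real.sqrt (4 * S ^ 2 + w ^ 2)))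
      ((-S * (C * Real.sqrt (4 * S ^ 2 + w ^ 2)) -
          S * (2 - w) * (C * (2 * w / (2 * Real.sqrt (4 * S ^ 2 + w ^ 2))))) /
        (C * Real.sqrt (4 * S ^ 2 + w ^ 2)) ^ 2) w :=
    hnum.div hden (by positivity)
  -- arcsin θ(w)
  have hθsq := one_sub_theta_sq (w := w) hS hC hCS
  have hpos : 0 < 1 - (S * (2 - w) / (C * Real.sqrt (4 * S ^ 2 + w ^ 2))) ^ 2 := by
    rw [hθsq]
    have : 0 < w + 2 * S ^ 2 := by linarith
    positivity
  have hx1 : S * (2 - w) / (C * Real.sqrt (4 * S ^ 2 + w ^ 2)) ≠ -1 := by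
    intro h; rw [h] at hpos; norm_num at hpos
  have hx2 : S * (2 - w) / (C * Real.sqrt (4 * S ^ 2 + w ^ 2)) ≠ 1 := by
    intro h; rw [h] at hpos; norm_num at hpos
  have hroot : Real.sqrt (1 - (S * (2 - w) / (C * Real.sqrt (4 * S ^ 2 + w ^ 2))) ^ 2) =
      (w + 2 * S ^ 2) / (C * Real.sqrt (4 * S ^ 2 + w ^ 2)) := by
    rw [hθsq, Real.sqrt_div (sq_nonneg _), Real.sqrt_sq (by linarith), Real.sqrt_mul (sq_nonneg _),
      Real.sqrt_sq hC.le]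
  have harc' := (Real.hasDerivAt_arcsin hx1 hx2).comp w hθ
  have harc : HasDerivAt
      (fun w => Real.arcsin (S * (2 - w) / (C * Real.sqrt (4 * S ^ 2 + w ^ 2)))) _ w := harc'
  -- the polynomial factor and the log part
  have hP0 : HasDerivAt (fun w => 4 * S ^ 2 * w + w ^ 3 / 3)
      (4 * S ^ 2 * 1 + (↑(3 : ℕ) * w ^ (3 - 1)) / 3) w :=
    ((hasDerivAt_id w).const_mul (4 * S ^ 2)).add ((hasDerivAt_pow 3 w).div_const 3)
  have hP : HasDerivAt (fun w => 4 * S ^ 2 * w + w ^ 3 / 3) (4 * S ^ 2 + w ^ 2) w :=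
    hP0.congr_deriv (by norm_num)
  have hlog : HasDerivAt (fun w => Real.log (4 * S ^ 2 + w ^ 2))
      (2 * w / (4 * S ^ 2 + w ^ 2)) w := hin.log hρpos.ne'
  have hQ : HasDerivAt (fun w => 2 * S * (w ^ 2 / 6 + 4 * S ^ 2 / 3 * Real.log (4 * S ^ 2 + w ^ 2)))
      (2 * S * (2 * w / 6 + 4 * S ^ 2 / 3 * (2 * w / (4 * S ^ 2 + w ^ 2)))) w := by
    have h1 : HasDerivAt (fun w : ℝ => w ^ 2 / 6) (2 * w / 6) w := by
      have := (hasDerivAt_pow 2 w).div_const 6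
      simpa using this
    exact (h1.add (hlog.const_mul _)).const_mul _
  have hsum : HasDerivAt (fun w => (4 * S ^ 2 * w + w ^ 3 / 3) *
          Real.arcsin (S * (2 - w) / (C * Real.sqrt (4 * S ^ 2 + w ^ 2))) +
        2 * S * (w ^ 2 / 6 + 4 * S ^ 2 / 3 * Real.log (4 * S ^ 2 + w ^ 2))) _ w :=
    (hP.mul harc).add hQ
  refine hsum.congr_deriv ?_
  have hne1 : w + 2 * S ^ 2 ≠ 0 := by linarith
  have hne2 : S ^ 2 * 2 + w ≠ 0 := by linarith
  have hne3 : 2 * S ^ 2 + w ≠ 0 := by linarith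
  have hne4 : w + S ^ 2 * 2 ≠ 0 := by linarith
  rw [hroot]
  field_simp
  simp only [hρ2]
  ring

/-- **The radial section of the slice.** For `ℓ > 0`, `|u| + |w| < 2`, `S > 0`, `C² = 1 + S²`:
`√(u² + ℓ²C²) + √(w² + ℓ²S²) < 2 ⟺ ℓ² < 4 + w² − u² + 8S² − 4√(C²(4S²+w²) − S²u²)`
(the smaller root of the quadratic obtained by squaring twice). [folklore] -/
theorem slice_radius_iff {S C u w ℓ : ℝ} (hS : 0 < S) (hC : 0 < C) (hCS : C ^ 2 = 1 + S ^ 2)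
    (hℓ : 0 < ℓ) (huw : |u| + |w| < 2) :
    Real.sqrt (u ^ 2 + (ℓ * C) ^ 2) + Real.sqrt (w ^ 2 + (ℓ * S) ^ 2) < 2 ↔
      ℓ ^ 2 < 4 + w ^ 2 - u ^ 2 + 8 * S ^ 2 -
        4 * Real.sqrt (C ^ 2 * (4 * S ^ 2 + w ^ 2) - S ^ 2 * u ^ 2) := by
  have hu2 : u ^ 2 < 4 := by
    have hu : |u| < 2 := by linarith [abs_nonneg w]
    have := abs_lt.mp hu
    nlinarith
  have hw2 : w ^ 2 < 4 := by
    have hw : |w| < 2 := by linarith [abs_nonneg u]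
    have := abs_lt.mp hw
    nlinarith
  -- the radicand `Rd = C²(4S²+w²) − S²u² = 4S⁴ + S²K + w²`, `K = 4 + w² − u²`
  set K := 4 + w ^ 2 - u ^ 2 with hK
  have hKpos : 0 < K := by rw [hK]; nlinarith [sq_nonneg w]
  have hRd : C ^ 2 * (4 * S ^ 2 + w ^ 2) - S ^ 2 * u ^ 2 = 4 * S ^ 4 + S ^ 2 * K + w ^ 2 := by
    rw [hCS, hK]; ring
  have hRdpos : 0 < C ^ 2 * (4 * S ^ 2 + w ^ 2) - S ^ 2 * u ^ 2 := by rw [hRd]; positivity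
  set D := Real.sqrt (C ^ 2 * (4 * S ^ 2 + w ^ 2) - S ^ 2 * u ^ 2) with hD
  have hD0 : 0 ≤ D := Real.sqrt_nonneg _
  have hD2 : D ^ 2 = 4 * S ^ 4 + S ^ 2 * K + w ^ 2 := by rw [hD, Real.sq_sqrt hRdpos.le, hRd]
  set Aa := Real.sqrt (u ^ 2 + (ℓ * C) ^ 2) with hAa
  set Bb := Real.sqrt (w ^ 2 + (ℓ * S) ^ 2) with hBb
  have hA0 : 0 ≤ Aa := Real.sqrt_nonneg _
  have hB0 : 0 ≤ Bb := Real.sqrt_nonneg _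
  have hA2 : Aa ^ 2 = u ^ 2 + (ℓ * C) ^ 2 := Real.sq_sqrt (by positivity)
  have hB2 : Bb ^ 2 = w ^ 2 + (ℓ * S) ^ 2 := Real.sq_sqrt (by positivity)
  -- key polynomial identity: (ℓ² − K − 8S²)² − 16 D² = (K − ℓ²)² − 16 (w² + ℓ² S²)
  have hQ : (ℓ ^ 2 - K - 8 * S ^ 2) ^ 2 - 16 * D ^ 2 =
      (K - ℓ ^ 2) ^ 2 - 16 * (w ^ 2 + ℓ ^ 2 * S ^ 2) := by
    rw [hD2]; ring
  have e : (ℓ * C) ^ 2 = ℓ ^ 2 + (ℓ * S) ^ 2 := by rw [mul_pow, hCS]; ring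
  have hBexp : (2 - Bb) ^ 2 = 4 - 4 * Bb + (w ^ 2 + (ℓ * S) ^ 2) := by rw [← hB2]; ring
  have hS2 : 0 < S ^ 2 := by positivity
  constructor
  · intro h
    have h1 : Aa < 2 - Bb := by linarith
    have h2 : Aa ^ 2 < (2 - Bb) ^ 2 := by
      have hm := mul_pos (by linarith : (0 : ℝ) < 2 - Bb - Aa) (by linarith : (0 : ℝ) < 2 - Bb + Aa)
      linarith [hm]
    have h3 : 4 * Bb < K - ℓ ^ 2 := by
      rw [hA2, hBexp] at h2
      rw [hK]
      linarith [e]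
    have h4 : 16 * (w ^ 2 + ℓ ^ 2 * S ^ 2) < (K - ℓ ^ 2) ^ 2 := by
      have hm := mul_self_lt_mul_self (by positivity : (0 : ℝ) ≤ 4 * Bb) h3
      have : (4 * Bb) * (4 * Bb) = 16 * (w ^ 2 + (ℓ * S) ^ 2) := by rw [← hB2]; ring
      rw [this] at hm
      linarith [hm]
    have h5 : 16 * D ^ 2 < (ℓ ^ 2 - K - 8 * S ^ 2) ^ 2 := by linarith [hQ]
    have h6 : ℓ ^ 2 < K := by linarith
    by_contra hcon
    have hcon' : 0 ≤ ℓ ^ 2 - K - 8 * S ^ 2 + 4 * D := by rw [hK] at hcon ⊢; linarith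
    have hneg : ℓ ^ 2 - K - 8 * S ^ 2 ≤ 0 := by linarith
    have hm := mul_nonneg hcon' (by linarith : 0 ≤ 4 * D - (ℓ ^ 2 - K - 8 * S ^ 2))
    linarith [hm]
  · intro h
    have hLK : 2 * S ^ 2 ≤ D := by
      rw [hD]
      calc 2 * S ^ 2 = Real.sqrt ((2 * S ^ 2) ^ 2) := (Real.sqrt_sq (by positivity)).symm
        _ ≤ Real.sqrt (C ^ 2 * (4 * S ^ 2 + w ^ 2) - S ^ 2 * u ^ 2) :=
          Real.sqrt_le_sqrt (by rw [hRd]; nlinarith [sq_nonneg w, hKpos])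
    have h6 : ℓ ^ 2 < K := by linarith
    have h5 : 16 * D ^ 2 < (ℓ ^ 2 - K - 8 * S ^ 2) ^ 2 := by
      have hlt : 4 * D < -(ℓ ^ 2 - K - 8 * S ^ 2) := by linarith
      have hm := mul_self_lt_mul_self (by positivity : (0 : ℝ) ≤ 4 * D) hlt
      linarith [hm]
    have h4 : 16 * (w ^ 2 + ℓ ^ 2 * S ^ 2) < (K - ℓ ^ 2) ^ 2 := by linarith [hQ]
    have h3 : 4 * Bb < K - ℓ ^ 2 := by
      refine lt_of_pow_lt_pow_left₀ 2 (by linarith : 0 ≤ K - ℓ ^ 2) ?_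
      have : (4 * Bb) ^ 2 = 16 * (w ^ 2 + ℓ ^ 2 * S ^ 2) := by rw [mul_pow, hB2]; ring
      rw [this]
      exact h4
    have hK8 : K < 8 := by rw [hK]; nlinarith [sq_nonneg u]
    have hBlt : Bb < 2 := by
      have hl2 : 0 ≤ ℓ ^ 2 := by positivity
      linarith
    have h2 : Aa ^ 2 < (2 - Bb) ^ 2 := by
      rw [hA2, hBexp]
      rw [hK] at h3
      linarith [e]
    have h1 : Aa < 2 - Bb := lt_of_pow_lt_pow_left₀ 2 (by linarith) h2
    linarith

/-- `∫_{0<ℓ<r} ℓ dℓ = r²/2` as a Lebesgue integral (`r ≥ 0`). [folklore] -/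
theorem setLIntegral_Ioo_ofReal_self {r : ℝ} (hr : 0 ≤ r) :
    ∫⁻ ℓ in Ioo (0 : ℝ) r, ENNReal.ofReal ℓ = ENNReal.ofReal (r ^ 2 / 2) := by
  have hint : ∫ ℓ in (0 : ℝ)..r, ℓ = r ^ 2 / 2 := by rw [integral_id]; ring
  rw [← hint, intervalIntegral.integral_of_le hr, integral_Ioc_eq_integral_Ioo,
    ofReal_integral_eq_lintegral_ofReal]
  · exact continuous_id.integrableOn_Icc.mono_set Ioo_subset_Icc_self
  · exact (ae_restrict_iff' measurableSet_Ioo).mpr (ae_of_all _ fun ℓ hℓ => hℓ.1.le)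

/-- Positivity of the slice radius: for `|u| + |w| < 2`,
`0 < 4 + w² − u² + 8S² − 4√(C²(4S²+w²) − S²u²)`. [folklore] -/
theorem slice_radius_pos {S C u w : ℝ} (hS : 0 < S) (hCS : C ^ 2 = 1 + S ^ 2)
    (huw : |u| + |w| < 2) :
    0 < 4 + w ^ 2 - u ^ 2 + 8 * S ^ 2 -
      4 * Real.sqrt (C ^ 2 * (4 * S ^ 2 + w ^ 2) - S ^ 2 * u ^ 2) := by
  have hu := abs_nonneg u
  have hw := abs_nonneg w
  have hu2 : u ^ 2 = |u| ^ 2 := (sq_abs u).symm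
  have hw2 : w ^ 2 = |w| ^ 2 := (sq_abs w).symm
  have hRd : C ^ 2 * (4 * S ^ 2 + w ^ 2) - S ^ 2 * u ^ 2 =
      4 * S ^ 4 + S ^ 2 * (4 + w ^ 2 - u ^ 2) + w ^ 2 := by rw [hCS]; ring
  have hK : 4 * |w| < 4 + w ^ 2 - u ^ 2 := by
    rw [hu2, hw2]; nlinarith
  have hKpos : 0 < 4 + w ^ 2 - u ^ 2 := by linarith
  have hRdpos : 0 < C ^ 2 * (4 * S ^ 2 + w ^ 2) - S ^ 2 * u ^ 2 := by
    rw [hRd]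
    have h4 : 0 < 4 * S ^ 4 := by positivity
    have h5 : 0 ≤ S ^ 2 * (4 + w ^ 2 - u ^ 2) := mul_nonneg (sq_nonneg S) hKpos.le
    nlinarith [sq_nonneg w]
  -- 4 D < K + 8 S²  ⟸  16 D² < (K + 8S²)²  ⟺  16 w² < K²
  have hlt : 4 * Real.sqrt (C ^ 2 * (4 * S ^ 2 + w ^ 2) - S ^ 2 * u ^ 2) <
      4 + w ^ 2 - u ^ 2 + 8 * S ^ 2 := by
    rw [show 4 * Real.sqrt (C ^ 2 * (4 * S ^ 2 + w ^ 2) - S ^ 2 * u ^ 2) =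
        Real.sqrt (16 * (C ^ 2 * (4 * S ^ 2 + w ^ 2) - S ^ 2 * u ^ 2)) by
      rw [Real.sqrt_mul (by norm_num), show Real.sqrt 16 = 4 by
        rw [show (16 : ℝ) = 4 ^ 2 by norm_num, Real.sqrt_sq (by norm_num)]]]
    rw [Real.sqrt_lt' (by nlinarith [sq_nonneg w, hKpos]), hRd]
    rw [hw2] at hK ⊢
    rw [hu2] at hK ⊢
    nlinarith
  linarith

/-- **The radial integral of the slice.** For fixed `(u, w)`:
`∫_{ℓ>0} ℓ · 𝟙[√(u²+ℓ²C²) + √(w²+ℓ²S²) < 2] dℓ = ½ L(u,w)` if `|u| + |w| < 2` and `0` otherwise,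
`L = 4 + w² − u² + 8S² − 4√(C²(4S²+w²) − S²u²)`. [folklore] -/
theorem slice_radial_lintegral {S C : ℝ} (hS : 0 < S) (hC : 0 < C) (hCS : C ^ 2 = 1 + S ^ 2)
    (u w : ℝ) :
    ∫⁻ ℓ in Ioi (0 : ℝ), {ℓ : ℝ | Real.sqrt (u ^ 2 + (ℓ * C) ^ 2) +
        Real.sqrt (w ^ 2 + (ℓ * S) ^ 2) < 2}.indicator (fun ℓ => ENNReal.ofReal ℓ) ℓ =
      if |u| + |w| < 2 then ENNReal.ofReal ((4 + w ^ 2 - u ^ 2 + 8 * S ^ 2 -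
        4 * Real.sqrt (C ^ 2 * (4 * S ^ 2 + w ^ 2) - S ^ 2 * u ^ 2)) / 2) else 0 := by
  have hmeas : MeasurableSet {ℓ : ℝ | Real.sqrt (u ^ 2 + (ℓ * C) ^ 2) +
      Real.sqrt (w ^ 2 + (ℓ * S) ^ 2) < 2} :=
    measurableSet_lt (by fun_prop) measurable_const
  rw [lintegral_indicator hmeas, Measure.restrict_restrict hmeas]
  split_ifs with huw
  · set L := 4 + w ^ 2 - u ^ 2 + 8 * S ^ 2 -
      4 * Real.sqrt (C ^ 2 * (4 * S ^ 2 + w ^ 2) - S ^ 2 * u ^ 2) with hL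
    have hLpos : 0 < L := slice_radius_pos hS hCS huw
    have hset : {ℓ : ℝ | Real.sqrt (u ^ 2 + (ℓ * C) ^ 2) +
        Real.sqrt (w ^ 2 + (ℓ * S) ^ 2) < 2} ∩ Ioi 0 = Ioo 0 (Real.sqrt L) := by
      ext ℓ
      simp only [mem_inter_iff, mem_setOf_eq, mem_Ioi, mem_Ioo]
      constructor
      · rintro ⟨h, hℓ⟩
        refine ⟨hℓ, ?_⟩
        rw [Real.lt_sqrt hℓ.le]
        exact (slice_radius_iff hS hC hCS hℓ huw).mp h
      · rintro ⟨hℓ, h⟩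
        refine ⟨?_, hℓ⟩
        rw [Real.lt_sqrt hℓ.le] at h
        exact (slice_radius_iff hS hC hCS hℓ huw).mpr h
    rw [hset, setLIntegral_Ioo_ofReal_self (Real.sqrt_nonneg _), Real.sq_sqrt hLpos.le]
  · have hset : {ℓ : ℝ | Real.sqrt (u ^ 2 + (ℓ * C) ^ 2) +
        Real.sqrt (w ^ 2 + (ℓ * S) ^ 2) < 2} ∩ Ioi 0 = ∅ := by
      ext ℓ
      simp only [mem_inter_iff, mem_setOf_eq, mem_Ioi, mem_empty_iff_false, iff_false, not_and]
      intro h hℓ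
      have h1 : |u| < Real.sqrt (u ^ 2 + (ℓ * C) ^ 2) := by
        rw [Real.lt_sqrt (abs_nonneg u), sq_abs]
        have : 0 < (ℓ * C) ^ 2 := by positivity
        linarith
      have h2 : |w| ≤ Real.sqrt (w ^ 2 + (ℓ * S) ^ 2) := by
        refine Real.le_sqrt_of_sq_le ?_
        rw [sq_abs]
        have : 0 ≤ (ℓ * S) ^ 2 := by positivity
        linarith
      have huw' : 2 ≤ |u| + |w| := not_lt.mp huw
      linarith
    rw [hset, Measure.restrict_empty, lintegral_zero_measure]

/-- Non-strict version of `slice_radius_pos` on the closed region `|u| + |w| ≤ 2`. [folklore] -/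
theorem slice_radius_nonneg {S C u w : ℝ} (hS : 0 < S) (hCS : C ^ 2 = 1 + S ^ 2)
    (huw : |u| + |w| ≤ 2) :
    0 ≤ 4 + w ^ 2 - u ^ 2 + 8 * S ^ 2 -
      4 * Real.sqrt (C ^ 2 * (4 * S ^ 2 + w ^ 2) - S ^ 2 * u ^ 2) := by
  have hu := abs_nonneg u
  have hw := abs_nonneg w
  have hu2 : u ^ 2 = |u| ^ 2 := (sq_abs u).symm
  have hw2 : w ^ 2 = |w| ^ 2 := (sq_abs w).symm
  have hRd : C ^ 2 * (4 * S ^ 2 + w ^ 2) - S ^ 2 * u ^ 2 =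
      4 * S ^ 4 + S ^ 2 * (4 + w ^ 2 - u ^ 2) + w ^ 2 := by rw [hCS]; ring
  have hK : 4 * |w| ≤ 4 + w ^ 2 - u ^ 2 := by
    rw [hu2, hw2]; nlinarith
  have hKnn : 0 ≤ 4 + w ^ 2 - u ^ 2 := by linarith
  have hle : 4 * Real.sqrt (C ^ 2 * (4 * S ^ 2 + w ^ 2) - S ^ 2 * u ^ 2) ≤
      4 + w ^ 2 - u ^ 2 + 8 * S ^ 2 := by
    rw [show 4 * Real.sqrt (C ^ 2 * (4 * S ^ 2 + w ^ 2) - S ^ 2 * u ^ 2) =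
        Real.sqrt (16 * (C ^ 2 * (4 * S ^ 2 + w ^ 2) - S ^ 2 * u ^ 2)) by
      rw [Real.sqrt_mul (by norm_num), show Real.sqrt 16 = 4 by
        rw [show (16 : ℝ) = 4 ^ 2 by norm_num, Real.sqrt_sq (by norm_num)]]]
    refine Real.sqrt_le_iff.mpr ⟨by positivity, ?_⟩
    rw [hRd]
    rw [hw2] at hK ⊢
    rw [hu2] at hK ⊢
    nlinarith
  linarith

end Literature.Probability.RandomMatrix.LovasAndai

end
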